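import Summits.QuantumAdvantage.QuantumAdvantage.Theorems.LinnikCubicClassGroupsDegreeOnePrimesEscapeResidueBrauerSiegel
import Summits.QuantumAdvantage.QuantumAdvantage.Theorems.LinnikCubicClassGroupsDegreeOnePrimesEscapeResidueUpper
import Mathlib.NumberTheory.NumberField.CMField
import Mathlib.NumberTheory.NumberField.Discriminant.Different
import Literature.NumberTheory.LFunctions.RelativeClassNumberFormulaProofs
import HarnessLib

/-!
# The Brauer–Siegel theorem for the relative class number of CM fields:
# `h_K ≥ c(n,ε) |d_K|^{1/4−ε} · h_{K⁺}`, and finiteness of CM fields of given degree and class number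

Topic `Summits/QuantumAdvantage/QuantumAdvantage/Theorems`, helper file for the crux
`DegreeOnePrimesEscape` (stmt-QuantumAdvantage-11543, closed) of route `LinnikCubicClassGroups`;
cell B2b-1 (linnik-cubic), PART A. HONEST FRAMING: the value of this file is a THEOREM
(kernel-checked; ineffective constant) — NOT summit progress.

Let `K` be a CM field (`NumberField.IsCMField K`: a totally complex quadratic extension of its
maximal real subfield `K⁺`), `[K⁺:ℚ] = n ≥ 2`, so `[K:ℚ] = 2n`. Dividing the class number formulas
(`NumberField.dedekindZeta_residue_def`)

  `κ_K = (2π)^n h_K R_K / (w_K √|d_K|)`,  `κ_{K⁺} = 2^n h_{K⁺} R_{K⁺} / (2 √|d_{K⁺}|)`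

(`w_{K⁺} = 2`, the tree's `RelativeClassNumber.torsionOrder_eq_two_of_isTotallyReal`) and using
* `R_K / R_{K⁺} = 2^{n−1}/Q_K`, `Q_K ∈ {1,2}` (Mathlib:
  `IsCMField.regulator_div_regulator_eq_two_pow_mul_indexRealUnits_inv`), so `R_K ≤ 2^{n−1} R_{K⁺}`;
* `|d_{K⁺}|² ∣ |d_K|` (transitivity of the different, Mathlib:
  `natAbs_discr_eq_absNorm_differentIdeal_mul_natAbs_discr_pow`), so `√(|d_K|/|d_{K⁺}|) ≥ |d_K|^{1/4}`;
* the tree's Brauer–Siegel lower bound `κ_K ≥ C(2n,ε)|d_K|^{−ε}` (`Residue.residue_ge_rpow_neg`,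
  ineffective) and Landau's upper bound `κ_{K⁺} ≤ 2^{n+1}e^{1/2}(log|d_{K⁺}|)^{n−1}`
  (`Residue.residue_le_log_pow`),
one gets the **Brauer–Siegel theorem for the relative class number `h_K⁻ = h_K/h_{K⁺}`**:

* `classNumber_ge_mul_classNumber_maximalRealSubfield` — for `n ≥ 2`, `ε > 0` there is `c > 0` with
  **`h_K ≥ c · |d_K|^{1/4 − ε} · h_{K⁺}`** for every CM field `K` of degree `2n`;
* `classNumber_ge_rpow` — hence `h_K ≥ c|d_K|^{1/4−ε}`: **the class number of CM fields of fixed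
  degree tends to infinity with the discriminant**;
* `absdiscr_le_of_classNumber_le` — for every `n ≥ 2` and `H` there is `D` such that every CM field
  of degree `2n` with `h_K ≤ H` has `|d_K| ≤ D` (with Hermite's theorem: **only finitely many CM
  fields of a given degree have class number `≤ H`**).

In print: Stark 1974 (Thm. 2, effective for `n` large via his zero-repulsion), Odlyzko 1975,
Hoffstein 1979; the ineffective fixed-degree statement is the Brauer–Siegel theorem applied to `K`
and `K⁺` (e.g. Washington, *Cyclotomic Fields*, Thm. 4.20 and its proof for general CM fields).
Mathlib has the CM-field unit index and regulator ratio but no class number asymptotics.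

## References

* H. M. Stark, *Some effective cases of the Brauer–Siegel theorem*, Invent. Math. 23 (1974)
  135–152, Thm. 2. [Stark1974]
* L. C. Washington, *Introduction to Cyclotomic Fields*, GTM 83, Thm. 4.20. [Washington1997]
-/

noncomputable section

open scoped NumberField
open Complex Filter Topology Set NumberField NumberField.InfinitePlace NumberField.Units

namespace Summit.QuantumAdvantage.QuantumAdvantage.Theorems.DegreeOnePrimesEscape

namespace CMField

/-! ### Invariants of a CM field against those of its maximal real subfield -/

section CM

variable (K : Type) [Field K] [NumberField K] [IsCMField K]

local notation3 "K⁺" => maximalRealSubfield K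

/-- `[K:ℚ] = 2[K⁺:ℚ]` for a CM field. [folklore] -/
theorem finrank_eq_two_mul : Module.finrank ℚ K = 2 * Module.finrank ℚ K⁺ := by
  rw [← Module.finrank_mul_finrank ℚ K⁺ K, Algebra.IsQuadraticExtension.finrank_eq_two K⁺ K,
    mul_comm]

/-- `r₂(K) = [K⁺:ℚ]` for a CM field. [folklore] -/
theorem nrComplexPlaces_eq : nrComplexPlaces K = Module.finrank ℚ K⁺ := by
  have h1 := IsTotallyComplex.finrank (K := K)
  have h2 := finrank_eq_two_mul K
  omega

/-- The unit rank of a CM field is `[K⁺:ℚ] − 1`. [folklore] -/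
theorem units_rank_eq : Units.rank K = Module.finrank ℚ K⁺ - 1 := by
  rw [Units.rank, card_eq_nrRealPlaces_add_nrComplexPlaces, IsTotallyComplex.nrRealPlaces_eq_zero,
    nrComplexPlaces_eq, zero_add]

/-- **`R_K ≤ 2^{[K⁺:ℚ]−1} R_{K⁺}`** for a CM field (`R_K/R_{K⁺} = 2^{r}/Q`, `Q ∈ {1,2}`, Mathlib).
[folklore] -/
theorem regulator_le : regulator K ≤ 2 ^ (Module.finrank ℚ K⁺ - 1) * regulator K⁺ := by
  have h := IsCMField.regulator_div_regulator_eq_two_pow_mul_indexRealUnits_inv K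
  have hRF := regulator_pos K⁺
  rw [div_eq_iff hRF.ne', units_rank_eq] at h
  have hidx : (1 : ℝ) ≤ (IsCMField.indexRealUnits K : ℝ) := by
    rcases IsCMField.indexRealUnits_eq_one_or_two K with h1 | h2
    · rw [h1]; norm_num
    · rw [h2]; norm_num
  have hinv : ((IsCMField.indexRealUnits K : ℝ))⁻¹ ≤ 1 := inv_le_one_of_one_le₀ hidx
  rw [h]
  have h2 : (0 : ℝ) ≤ 2 ^ (Module.finrank ℚ K⁺ - 1) * regulator K⁺ := by positivity
  calc 2 ^ (Module.finrank ℚ K⁺ - 1) * ((IsCMField.indexRealUnits K : ℝ))⁻¹ * regulator K⁺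
      = ((IsCMField.indexRealUnits K : ℝ))⁻¹ * (2 ^ (Module.finrank ℚ K⁺ - 1) * regulator K⁺) := by
        ring
    _ ≤ 1 * (2 ^ (Module.finrank ℚ K⁺ - 1) * regulator K⁺) :=
        mul_le_mul_of_nonneg_right hinv h2
    _ = _ := one_mul _

/-- **`|d_{K⁺}|² ≤ |d_K|`** for a CM field (`|d_K| = N(𝔡_{K/K⁺})·|d_{K⁺}|²`). [folklore] -/
theorem natAbs_discr_sq_le : (discr K⁺).natAbs ^ 2 ≤ (discr K).natAbs := by
  have e := NumberField.natAbs_discr_eq_absNorm_differentIdeal_mul_natAbs_discr_pow K⁺ (𝓞 K⁺) K (𝓞 K)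
  rw [Algebra.IsQuadraticExtension.finrank_eq_two K⁺ K] at e
  have hne : Ideal.absNorm (differentIdeal (𝓞 K⁺) (𝓞 K)) ≠ 0 := by
    intro h0
    rw [h0, zero_mul] at e
    exact (Int.natAbs_ne_zero.2 (discr_ne_zero K)) e
  calc (discr K⁺).natAbs ^ 2 = 1 * (discr K⁺).natAbs ^ 2 := by ring
    _ ≤ _ := by rw [e]; exact Nat.mul_le_mul_right _ (Nat.one_le_iff_ne_zero.2 hne)

/-- `|d_{K⁺}| ≤ |d_K|^{1/2}` (real form). [folklore] -/
theorem absdiscr_maximalRealSubfield_le_rpow :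
    ((discr K⁺).natAbs : ℝ) ≤ ((discr K).natAbs : ℝ) ^ (1 / 2 : ℝ) := by
  have h := natAbs_discr_sq_le K
  have h' : ((discr K⁺).natAbs : ℝ) ^ 2 ≤ ((discr K).natAbs : ℝ) := by exact_mod_cast h
  have h0 : (0 : ℝ) ≤ ((discr K⁺).natAbs : ℝ) := Nat.cast_nonneg _
  calc ((discr K⁺).natAbs : ℝ) = (((discr K⁺).natAbs : ℝ) ^ 2) ^ (1 / 2 : ℝ) := by
        rw [← Real.sqrt_eq_rpow, Real.sqrt_sq h0]
    _ ≤ ((discr K).natAbs : ℝ) ^ (1 / 2 : ℝ) := Real.rpow_le_rpow (by positivity) h' (by norm_num)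

/-- **The class number formula of `K`, solved for `h_K`**: `h_K = κ_K w_K √|d_K| / ((2π)^n R_K)`,
`n = [K⁺:ℚ]`. [folklore] -/
theorem classNumber_eq :
    (classNumber K : ℝ) = dedekindZeta_residue K * ((torsionOrder K : ℝ) *
        Real.sqrt ((discr K).natAbs : ℝ)) / ((2 * Real.pi) ^ Module.finrank ℚ K⁺ * regulator K) := by
  have h := dedekindZeta_residue_def K
  rw [IsTotallyComplex.nrRealPlaces_eq_zero, nrComplexPlaces_eq, pow_zero, one_mul] at h
  have hR := regulator_pos K
  have hw : (0 : ℝ) < torsionOrder K := by exact_mod_cast torsionOrder_pos K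
  have hd : (0 : ℝ) < ((discr K).natAbs : ℝ) := by exact_mod_cast Int.natAbs_pos.2 (discr_ne_zero K)
  have hsq : 0 < Real.sqrt ((discr K).natAbs : ℝ) := Real.sqrt_pos.2 hd
  have hcast : Real.sqrt (|(discr K : ℝ)|) = Real.sqrt ((discr K).natAbs : ℝ) := by
    rw [Nat.cast_natAbs, Int.cast_abs]
  have hπ : (0 : ℝ) < (2 * Real.pi) ^ Module.finrank ℚ K⁺ := by positivity
  rw [h, hcast]
  field_simp

omit [IsCMField K] in
/-- **The class number formula of `K⁺`, solved for `h_{K⁺}`**: `h_{K⁺} = κ_{K⁺}·2√|d_{K⁺}| / (2^n R_{K⁺})`.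
[folklore] -/
theorem classNumber_maximalRealSubfield_eq :
    (classNumber K⁺ : ℝ) = dedekindZeta_residue K⁺ * (2 * Real.sqrt ((discr K⁺).natAbs : ℝ)) /
        (2 ^ Module.finrank ℚ K⁺ * regulator K⁺) := by
  have h := dedekindZeta_residue_def K⁺
  rw [IsTotallyReal.nrComplexPlaces_eq_zero, ← IsTotallyReal.finrank, pow_zero, mul_one,
    Literature.NumberTheory.LFunctions.RelativeClassNumber.torsionOrder_eq_two_of_isTotallyReal] at h
  have hR := regulator_pos K⁺
  have hd : (0 : ℝ) < ((discr K⁺).natAbs : ℝ) := by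
    exact_mod_cast Int.natAbs_pos.2 (discr_ne_zero K⁺)
  have hsq : 0 < Real.sqrt ((discr K⁺).natAbs : ℝ) := Real.sqrt_pos.2 hd
  have hcast : Real.sqrt (|(discr K⁺ : ℝ)|) = Real.sqrt ((discr K⁺).natAbs : ℝ) := by
    rw [Nat.cast_natAbs, Int.cast_abs]
  rw [h]
  push_cast
  rw [hcast]
  field_simp

end CM

/-! ### The Brauer–Siegel theorem for the relative class number -/

/-- **Brauer–Siegel for the relative class number of CM fields.**  For every `n ≥ 2` and `ε > 0`
there is `c > 0` such that every CM field `K` of degree `2n` satisfies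
`h_K ≥ c · |d_K|^{1/4 − ε} · h_{K⁺}`, `K⁺` its maximal real subfield.
(Ineffective: the constant comes from the Siegel–Brauer lower bound for `κ_K`.)
[cite: Stark1974, Thm. 2 (context)] [cite: Washington1997, Thm. 4.20 (proof)] -/
theorem classNumber_ge_mul_classNumber_maximalRealSubfield (n : ℕ) (hn : 2 ≤ n) {ε : ℝ}
    (hε : 0 < ε) :
    ∃ c : ℝ, 0 < c ∧ ∀ (K : Type) [Field K] [NumberField K] [IsCMField K],
      Module.finrank ℚ K = 2 * n →
      c * ((discr K).natAbs : ℝ) ^ (1 / 4 - ε) * (classNumber (maximalRealSubfield K) : ℝ) ≤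
        classNumber K := by
  obtain ⟨C, hC, hκ⟩ := Residue.residue_ge_rpow_neg (2 * n) (by omega) (half_pos hε)
  -- `δ (n − 1) = ε/2`
  set δ : ℝ := ε / (2 * ((n : ℝ) - 1)) with hδ_def
  have hn1 : (0 : ℝ) < (n : ℝ) - 1 := by
    have : (2 : ℝ) ≤ n := by exact_mod_cast hn
    linarith
  have hδ : 0 < δ := by positivity
  set A : ℝ := 2 ^ (n + 1) * Real.exp (1 / 2) with hA_def
  have hA : 0 < A := by positivity
  refine ⟨C * δ ^ (n - 1) / (2 ^ (2 * n) * Real.exp (1 / 2) * Real.pi ^ n), by positivity,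
    fun K _ _ _ hK ↦ ?_⟩
  have hπ0 := Real.pi_pos
  -- notation and sizes
  have hnF : Module.finrank ℚ (maximalRealSubfield K) = n := by
    have := finrank_eq_two_mul K; omega
  have hnF2 : 1 < Module.finrank ℚ (maximalRealSubfield K) := by omega
  set dK : ℝ := ((discr K).natAbs : ℝ) with hdK
  set dF : ℝ := ((discr (maximalRealSubfield K)).natAbs : ℝ) with hdF
  have hdK3 : (3 : ℝ) ≤ dK := by
    rw [hdK]; exact_mod_cast Literature.NumberTheory.LFunctions.NumberField.three_le_natAbs_discr K (by omega)
  have hdF3 : (3 : ℝ) ≤ dF := by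
    rw [hdF]; exact_mod_cast
      Literature.NumberTheory.LFunctions.NumberField.three_le_natAbs_discr (maximalRealSubfield K) hnF2
  have hdK1 : (1 : ℝ) < dK := by linarith
  have hdF1 : (1 : ℝ) < dF := by linarith
  have hdK0 : (0 : ℝ) < dK := by linarith
  have hdF0 : (0 : ℝ) < dF := by linarith
  -- the residues
  have hκK : C * dK ^ (-(ε / 2)) ≤ dedekindZeta_residue K := hκ K hK
  have hκF : dedekindZeta_residue (maximalRealSubfield K) ≤ A * Real.log dF ^ (n - 1) := by
    have := Residue.residue_le_log_pow (maximalRealSubfield K) hnF2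
    rw [hnF] at this
    simpa [hA_def, hdF] using this
  -- `log d_F ≤ log d_K`, `(log d_K)^{n−1} ≤ d_K^{ε/2} / δ^{n−1}`
  have hdFK : dF ≤ dK := by
    have h := natAbs_discr_sq_le K
    have h' : dF ^ 2 ≤ dK := by rw [hdF, hdK]; exact_mod_cast h
    nlinarith
  have hlogF : Real.log dF ≤ Real.log dK := Real.log_le_log hdF0 hdFK
  have hlogF0 : 0 ≤ Real.log dF := Real.log_nonneg hdF1.le
  have hlogpow : Real.log dF ^ (n - 1) ≤ dK ^ (ε / 2) / δ ^ (n - 1) := by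
    have h1 : Real.log dF ^ (n - 1) ≤ Real.log dK ^ (n - 1) :=
      pow_le_pow_left₀ hlogF0 hlogF _
    have h2 : Real.log dK ≤ dK ^ δ / δ := Real.log_le_rpow_div hdK0.le hδ
    have h3 : Real.log dK ^ (n - 1) ≤ (dK ^ δ / δ) ^ (n - 1) :=
      pow_le_pow_left₀ (Real.log_nonneg hdK1.le) h2 _
    have h4 : (dK ^ δ / δ) ^ (n - 1) = dK ^ (ε / 2) / δ ^ (n - 1) := by
      rw [div_pow, ← Real.rpow_natCast (dK ^ δ), ← Real.rpow_mul hdK0.le]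
      congr 2
      rw [hδ_def, Nat.cast_sub (by omega : 1 ≤ n)]
      push_cast
      field_simp
    linarith [h4 ▸ h3]
  have hκF' : dedekindZeta_residue (maximalRealSubfield K) ≤ A * (dK ^ (ε / 2) / δ ^ (n - 1)) :=
    hκF.trans (mul_le_mul_of_nonneg_left hlogpow hA.le)
  -- `√d_F ≤ d_K^{1/4}`, `√d_K = d_K^{1/2}`
  have hsqF : Real.sqrt dF ≤ dK ^ (1 / 4 : ℝ) := by
    have h := absdiscr_maximalRealSubfield_le_rpow K
    rw [← hdF, ← hdK] at h
    calc Real.sqrt dF ≤ Real.sqrt (dK ^ (1 / 2 : ℝ)) := Real.sqrt_le_sqrt h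
      _ = dK ^ (1 / 4 : ℝ) := by
        rw [Real.sqrt_eq_rpow, ← Real.rpow_mul hdK0.le]; norm_num
  have hsqK : Real.sqrt dK = dK ^ (1 / 2 : ℝ) := Real.sqrt_eq_rpow dK
  -- regulators and roots of unity
  have hRK := regulator_pos K
  have hRF := regulator_pos (maximalRealSubfield K)
  have hreg : regulator K ≤ 2 ^ (n - 1) * regulator (maximalRealSubfield K) := by
    have := regulator_le K; rwa [hnF] at this
  have hwK : (2 : ℝ) ≤ torsionOrder K := by
    have h2 : 2 ≤ torsionOrder K := by
      obtain ⟨k, hk⟩ := even_torsionOrder K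
      have := torsionOrder_pos K
      omega
    exact_mod_cast h2
  -- the two class number formulas
  have hhK := classNumber_eq K
  have hhF := classNumber_maximalRealSubfield_eq K
  rw [hnF] at hhK hhF
  rw [← hdK] at hhK
  rw [← hdF] at hhF
  have hκK0 : 0 < dedekindZeta_residue K := dedekindZeta_residue_pos K
  have hκF0 : 0 < dedekindZeta_residue (maximalRealSubfield K) := dedekindZeta_residue_pos _
  -- lower bound for `h_K`:  `h_K ≥ C d_K^{−ε/2} · 2 d_K^{1/2} / ((2π)^n 2^{n−1} R_F)`
  have hK_lower : C * dK ^ (-(ε / 2)) * (2 * dK ^ (1 / 2 : ℝ)) /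
      ((2 * Real.pi) ^ n * (2 ^ (n - 1) * regulator (maximalRealSubfield K))) ≤ classNumber K := by
    rw [hhK, hsqK]
    have hnum : C * dK ^ (-(ε / 2)) * (2 * dK ^ (1 / 2 : ℝ)) ≤
        dedekindZeta_residue K * ((torsionOrder K : ℝ) * dK ^ (1 / 2 : ℝ)) := by
      have h1 : 2 * dK ^ (1 / 2 : ℝ) ≤ (torsionOrder K : ℝ) * dK ^ (1 / 2 : ℝ) :=
        mul_le_mul_of_nonneg_right hwK (by positivity)
      have h0 : 0 ≤ C * dK ^ (-(ε / 2)) := by positivity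
      calc C * dK ^ (-(ε / 2)) * (2 * dK ^ (1 / 2 : ℝ))
          ≤ C * dK ^ (-(ε / 2)) * ((torsionOrder K : ℝ) * dK ^ (1 / 2 : ℝ)) :=
            mul_le_mul_of_nonneg_left h1 h0
        _ ≤ dedekindZeta_residue K * ((torsionOrder K : ℝ) * dK ^ (1 / 2 : ℝ)) :=
            mul_le_mul_of_nonneg_right hκK (by positivity)
    have hden : (2 * Real.pi) ^ n * regulator K ≤
        (2 * Real.pi) ^ n * (2 ^ (n - 1) * regulator (maximalRealSubfield K)) :=
      mul_le_mul_of_nonneg_left hreg (by positivity)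
    exact div_le_div₀ (by positivity) hnum (by positivity) hden
  -- upper bound for `h_F`:  `h_F ≤ A (d_K^{ε/2}/δ^{n−1}) · 2 d_K^{1/4} / (2^n R_F)`
  have hF_upper : (classNumber (maximalRealSubfield K) : ℝ) ≤
      A * (dK ^ (ε / 2) / δ ^ (n - 1)) * (2 * dK ^ (1 / 4 : ℝ)) /
        (2 ^ n * regulator (maximalRealSubfield K)) := by
    rw [hhF]
    gcongr
  -- comparison of the two explicit quantities
  have hfinal : C * δ ^ (n - 1) / (2 ^ (2 * n) * Real.exp (1 / 2) * Real.pi ^ n) *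
      dK ^ (1 / 4 - ε) *
      (A * (dK ^ (ε / 2) / δ ^ (n - 1)) * (2 * dK ^ (1 / 4 : ℝ)) /
        (2 ^ n * regulator (maximalRealSubfield K))) =
      C * dK ^ (-(ε / 2)) * (2 * dK ^ (1 / 2 : ℝ)) /
        ((2 * Real.pi) ^ n * (2 ^ (n - 1) * regulator (maximalRealSubfield K))) := by
    -- powers of `d_K`: `d^{1/4−ε} · d^{ε/2} · d^{1/4} = d^{−ε/2} · d^{1/2}`
    have hpow : dK ^ (1 / 4 - ε) * dK ^ (ε / 2) * dK ^ (1 / 4 : ℝ) =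
        dK ^ (-(ε / 2)) * dK ^ (1 / 2 : ℝ) := by
      rw [← Real.rpow_add hdK0, ← Real.rpow_add hdK0, ← Real.rpow_add hdK0]
      norm_num
      ring_nf
    have hP5 : dK ^ (1 / 2 : ℝ) ≠ 0 := by positivity
    have hP4 : dK ^ (-(ε / 2)) =
        dK ^ (1 / 4 - ε) * dK ^ (ε / 2) * dK ^ (1 / 4 : ℝ) / dK ^ (1 / 2 : ℝ) := by
      rw [eq_div_iff hP5, hpow]
    -- powers of `2`: everything in terms of `2^{n−1}`
    have h2pow : (2 : ℝ) ^ (n - 1) * 2 = 2 ^ n := by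
      rw [← pow_succ]; congr 1; omega
    have e1 : (2 : ℝ) ^ (n + 1) = 2 ^ (n - 1) * 2 * 2 := by rw [pow_succ, ← h2pow]
    have e2 : (2 : ℝ) ^ (2 * n) = 2 ^ (n - 1) * 2 * (2 ^ (n - 1) * 2) := by
      rw [two_mul, pow_add, ← h2pow]
    have hδ0 : δ ^ (n - 1) ≠ 0 := pow_ne_zero _ hδ.ne'
    have hRF0 : regulator (maximalRealSubfield K) ≠ 0 := hRF.ne'
    have h2n : (2 : ℝ) ^ (n - 1) ≠ 0 := pow_ne_zero _ two_ne_zero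
    have hπn : Real.pi ^ n ≠ 0 := pow_ne_zero _ Real.pi_ne_zero
    have hexp : Real.exp (1 / 2) ≠ 0 := (Real.exp_pos _).ne'
    have hP1 : dK ^ (1 / 4 - ε) ≠ 0 := by positivity
    have hP2 : dK ^ (ε / 2) ≠ 0 := by positivity
    have hP3 : dK ^ (1 / 4 : ℝ) ≠ 0 := by positivity
    rw [hP4, hA_def, mul_pow, e1, e2, ← h2pow]
    field_simp
  calc C * δ ^ (n - 1) / (2 ^ (2 * n) * Real.exp (1 / 2) * Real.pi ^ n) * dK ^ (1 / 4 - ε) *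
        (classNumber (maximalRealSubfield K) : ℝ)
      ≤ C * δ ^ (n - 1) / (2 ^ (2 * n) * Real.exp (1 / 2) * Real.pi ^ n) * dK ^ (1 / 4 - ε) *
        (A * (dK ^ (ε / 2) / δ ^ (n - 1)) * (2 * dK ^ (1 / 4 : ℝ)) /
          (2 ^ n * regulator (maximalRealSubfield K))) :=
        mul_le_mul_of_nonneg_left hF_upper (by positivity)
    _ = _ := hfinal
    _ ≤ classNumber K := hK_lower

/-- **The class number of a CM field of fixed degree tends to infinity with the discriminant**:
for `n ≥ 2`, `ε > 0` there is `c > 0` with `h_K ≥ c|d_K|^{1/4−ε}` for every CM field `K` of degree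
`2n`. [cite: Stark1974, Thm. 2 (context)] -/
theorem classNumber_ge_rpow (n : ℕ) (hn : 2 ≤ n) {ε : ℝ} (hε : 0 < ε) :
    ∃ c : ℝ, 0 < c ∧ ∀ (K : Type) [Field K] [NumberField K] [IsCMField K],
      Module.finrank ℚ K = 2 * n → c * ((discr K).natAbs : ℝ) ^ (1 / 4 - ε) ≤ classNumber K := by
  obtain ⟨c, hc, h⟩ := classNumber_ge_mul_classNumber_maximalRealSubfield n hn hε
  refine ⟨c, hc, fun K _ _ _ hK ↦ ?_⟩
  have h1 := h K hK
  have hF : (1 : ℝ) ≤ classNumber (maximalRealSubfield K) := by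
    exact_mod_cast classNumber_pos (maximalRealSubfield K)
  have h0 : 0 ≤ c * ((discr K).natAbs : ℝ) ^ (1 / 4 - ε) := by positivity
  nlinarith

/-- **Only finitely many CM fields of a given degree have bounded class number** (discriminant
form): for `n ≥ 2` and every `H` there is `D` such that every CM field `K` of degree `2n` with
`h_K ≤ H` has `|d_K| ≤ D`. (Hermite's theorem, `NumberField.finite_of_discr_bdd`, turns a
discriminant bound into finiteness.) [cite: Stark1974, Thm. 2 (context)] -/
theorem absdiscr_le_of_classNumber_le (n : ℕ) (hn : 2 ≤ n) (H : ℝ) :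
    ∃ D : ℝ, ∀ (K : Type) [Field K] [NumberField K] [IsCMField K],
      Module.finrank ℚ K = 2 * n → (classNumber K : ℝ) ≤ H → ((discr K).natAbs : ℝ) ≤ D := by
  obtain ⟨c, hc, h⟩ := classNumber_ge_rpow n hn (by norm_num : (0 : ℝ) < 1 / 8)
  -- `c d^{1/8} ≤ h_K ≤ H` ⇒ `d ≤ (H/c)^8`
  refine ⟨(max (H / c) 0) ^ (8 : ℕ), fun K _ _ _ hK hH ↦ ?_⟩
  have h1 := h K hK
  rw [show (1 / 4 - 1 / 8 : ℝ) = 1 / 8 by norm_num] at h1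
  have hd0 : (0 : ℝ) ≤ ((discr K).natAbs : ℝ) := Nat.cast_nonneg _
  have h2 : ((discr K).natAbs : ℝ) ^ (1 / 8 : ℝ) ≤ H / c := by
    rw [le_div_iff₀ hc]; linarith
  have h3 : ((discr K).natAbs : ℝ) ^ (1 / 8 : ℝ) ≤ max (H / c) 0 := h2.trans (le_max_left _ _)
  calc ((discr K).natAbs : ℝ) = (((discr K).natAbs : ℝ) ^ (1 / 8 : ℝ)) ^ (8 : ℕ) := by
        rw [← Real.rpow_natCast, ← Real.rpow_mul hd0]; norm_num
    _ ≤ (max (H / c) 0) ^ (8 : ℕ) := pow_le_pow_left₀ (by positivity) h3 _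

end CMField

end Summit.QuantumAdvantage.QuantumAdvantage.Theorems.DegreeOnePrimesEscape

end
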